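import Mathlib
import Summits.Ventures.PercRepro2.OneTypedEdge
import Summits.Ventures.PercRepro2.TypedUntouched
import Summits.Ventures.PercRepro2.TypedRootPathTwo
import Summits.Ventures.PercRepro2.TypedSwapRoots

/-!
# A root-to-root path of three type-2 edges through `a₃` kills every typed base (blind cell
PercRepro2, night-3 g13, 2026-08-27; `proofs/NIGHT3-CERT.md` §22.6)

Let `e₁ = {a₁, a₃}`, `e₂ = {a₃, v}`, `e₃ = {v, a₂}` be typed edges of type `2` (each open in exactly
two of the three copies).  In a typed triple either some copy carries all three (then it joins the
roots, `Q` fails there and `K₃ = 0`), or the three copies close one edge each, and then every copy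
has `a₃ ∈ U` (`e₁` open, or `e₂, e₃` open through `v`), so `PD` fails in every copy and `K₃ = 0`
again — every term of the kernel carries a `PD`-factor in the first two copies
(`KB_eq_zero_of_pdB`).  Hence the typed base vanishes (`typedCount_eq_zero_of_root_path_three`;
the mirror `a₁ – v – a₃ – a₂` by the root symmetry is `typedCount_eq_zero_of_root_path_three'`).
On the ∣F∣ = 9 domain of record this is exactly the zero set of 1,646 positive instances (64 type
vectors each).
-/

namespace Summit.Ventures.PercRepro2

open UnionCluster

namespace CovForm

namespace RootPath

open OneTyped Untouched

section Kernel

/-- The kernel vanishes when `PD` fails in the first two copies. -/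
lemma KB_eq_zero_of_pdB (x y z : St) (hx : pdB x = 0) (hy : pdB y = 0) : KB x y z = 0 := by
  simp [KB, hx, hy]

/-- `PD` fails at a state with `a₃` in a root cluster. -/
lemma pdB_eq_zero_of_L3_or_H3 (s : St) (h : s.L3 = true ∨ s.H3 = true) : pdB s = 0 := by
  unfold pdB
  rcases h with h | h <;> simp [h]

end Kernel

section Main

open Classical

variable {V : Type*} {E : Type*} [Fintype E] [DecidableEq E] {R : Type*} [Field R]
variable (ends : E → Sym2 V) (o a₁ a₂ a₃ b : V)

omit [Fintype E] [DecidableEq E] in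
/-- Three edges each open in two of the three copies: some copy carries all three, or every copy
carries the first or the last two. -/
lemma all_open_or_cover {x y w : Config E} {e₁ e₂ e₃ : E}
    (h1 : (x e₁).toNat + (y e₁).toNat + (w e₁).toNat = 2)
    (h2 : (x e₂).toNat + (y e₂).toNat + (w e₂).toNat = 2)
    (h3 : (x e₃).toNat + (y e₃).toNat + (w e₃).toNat = 2) :
    ((x e₁ = true ∧ x e₂ = true ∧ x e₃ = true) ∨ (y e₁ = true ∧ y e₂ = true ∧ y e₃ = true) ∨
      (w e₁ = true ∧ w e₂ = true ∧ w e₃ = true)) ∨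
    ((x e₁ = true ∨ (x e₂ = true ∧ x e₃ = true)) ∧ (y e₁ = true ∨ (y e₂ = true ∧ y e₃ = true)) ∧
      (w e₁ = true ∨ (w e₂ = true ∧ w e₃ = true))) := by
  cases hx1 : x e₁ <;> cases hy1 : y e₁ <;> cases hw1 : w e₁ <;> cases hx2 : x e₂ <;>
    cases hy2 : y e₂ <;> cases hw2 : w e₂ <;> cases hx3 : x e₃ <;> cases hy3 : y e₃ <;>
    cases hw3 : w e₃ <;> simp_all

omit [Fintype E] [DecidableEq E] in
/-- A copy carrying `e₁`, or `e₂` and `e₃`, has `a₃` in a root cluster. -/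
lemma pdB_st_eq_zero {e₁ e₂ e₃ : E} {v : V} (he₁ : ends e₁ = s(a₁, a₃)) (he₂ : ends e₂ = s(a₃, v))
    (he₃ : ends e₃ = s(v, a₂)) (u : Config E) (h : u e₁ = true ∨ (u e₂ = true ∧ u e₃ = true)) :
    pdB (st ends o a₁ a₂ a₃ b u) = 0 := by
  apply pdB_eq_zero_of_L3_or_H3
  unfold st St.L3 St.H3
  rcases h with h | ⟨h2, h3⟩
  · exact Or.inl (decide_eq_true (conn_of_openAdj ⟨e₁, h, he₁⟩))
  · exact Or.inr (decide_eq_true (conn_symm (conn_trans (conn_of_openAdj ⟨e₂, h2, he₂⟩)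
      (conn_of_openAdj ⟨e₃, h3, he₃⟩))))

omit [Fintype E] [DecidableEq E] in
/-- A copy carrying all three edges joins the roots. -/
lemma q'_st_of_all_open {e₁ e₂ e₃ : E} {v : V} (he₁ : ends e₁ = s(a₁, a₃)) (he₂ : ends e₂ = s(a₃, v))
    (he₃ : ends e₃ = s(v, a₂)) (u : Config E) (h : u e₁ = true ∧ u e₂ = true ∧ u e₃ = true) :
    (st ends o a₁ a₂ a₃ b u).q' = true := by
  unfold st St.q'
  exact decide_eq_true (conn_symm (conn_trans (conn_trans (conn_of_openAdj ⟨e₁, h.1, he₁⟩)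
    (conn_of_openAdj ⟨e₂, h.2.1, he₂⟩)) (conn_of_openAdj ⟨e₃, h.2.2, he₃⟩)))

/-- **A root-to-root path of three type-2 edges through `a₃` kills every typed base.** -/
theorem typedCount_eq_zero_of_root_path_three {e₁ e₂ e₃ : E} {v : V} (he₁ : ends e₁ = s(a₁, a₃))
    (he₂ : ends e₂ = s(a₃, v)) (he₃ : ends e₃ = s(v, a₂)) (F : Finset E) (h1F : e₁ ∈ F)
    (h2F : e₂ ∈ F) (h3F : e₃ ∈ F) (z : Config E) (τ : E → ℕ) (hτ1 : τ e₁ = 2) (hτ2 : τ e₂ = 2)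
    (hτ3 : τ e₃ = 2) :
    typedCount F z τ (K3 ends o a₁ a₂ a₃ b : Config E → Config E → Config E → R) = 0 := by
  rw [← typedCount_zero_kernel F z τ]
  refine typedCount_congr_on_support F z τ fun x y w _ hτ' => ?_
  have h1 := hτ' e₁ h1F
  have h2 := hτ' e₂ h2F
  have h3 := hτ' e₃ h3F
  rw [hτ1] at h1
  rw [hτ2] at h2
  rw [hτ3] at h3
  rw [K3_eq_KB]
  rcases all_open_or_cover h1 h2 h3 with (hx | hy | hw) | ⟨hx, hy, _⟩
  · rw [KB_eq_zero_of_q' _ _ _ (Or.inl (q'_st_of_all_open ends o a₁ a₂ a₃ b he₁ he₂ he₃ x hx))]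
    simp
  · rw [KB_eq_zero_of_q' _ _ _ (Or.inr (Or.inl (q'_st_of_all_open ends o a₁ a₂ a₃ b he₁ he₂ he₃ y hy)))]
    simp
  · rw [KB_eq_zero_of_q' _ _ _ (Or.inr (Or.inr (q'_st_of_all_open ends o a₁ a₂ a₃ b he₁ he₂ he₃ w hw)))]
    simp
  · rw [KB_eq_zero_of_pdB _ _ _ (pdB_st_eq_zero ends o a₁ a₂ a₃ b he₁ he₂ he₃ x hx)
      (pdB_st_eq_zero ends o a₁ a₂ a₃ b he₁ he₂ he₃ y hy)]
    simp

/-- The mirror path `a₁ – v – a₃ – a₂` (by the root symmetry). -/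
theorem typedCount_eq_zero_of_root_path_three' {e₁ e₂ e₃ : E} {v : V} (he₁ : ends e₁ = s(a₂, a₃))
    (he₂ : ends e₂ = s(a₃, v)) (he₃ : ends e₃ = s(v, a₁)) (F : Finset E) (h1F : e₁ ∈ F)
    (h2F : e₂ ∈ F) (h3F : e₃ ∈ F) (z : Config E) (τ : E → ℕ) (hτ1 : τ e₁ = 2) (hτ2 : τ e₂ = 2)
    (hτ3 : τ e₃ = 2) :
    typedCount F z τ (K3 ends o a₁ a₂ a₃ b : Config E → Config E → Config E → R) = 0 := by
  rw [← SwapRoots.typedCount_swap_roots ends o a₁ a₂ a₃ b F z τ]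
  exact typedCount_eq_zero_of_root_path_three ends o a₂ a₁ a₃ b he₁ he₂ he₃ F h1F h2F h3F z τ hτ1
    hτ2 hτ3

end Main

end RootPath

end CovForm

end Summit.Ventures.PercRepro2
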